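import Summits.ResolutionOfSingularities.ResolutionOfSingularities.Theorems.FrobeniusLadderFInjectiveMacaulayficationJacobiMinor
import Summits.ResolutionOfSingularities.ResolutionOfSingularities.Theorems.FrobeniusLadderFInjectiveMacaulayficationNormBlockMatrix
import Summits.ResolutionOfSingularities.ResolutionOfSingularities.Theorems.FrobeniusLadderFInjectiveMacaulayficationNormBlockCerts
import Summits.ResolutionOfSingularities.ResolutionOfSingularities.Theorems.FrobeniusLadderFInjectiveMacaulayficationUnitRowMinors
import Mathlib.RingTheory.Localization.Submodule
import Mathlib.Data.Fintype.Sum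
import Mathlib.Tactic.IntervalCases
import Mathlib.Tactic.FieldSimp
import HarnessLib

/-!
# THE ONE-BLOCK NORM MODULE OF P2d4C IS `x⁻⁸·𝔮⁴`: minors of `X = x⁻²·W′` over the fraction field
# (kernel piece (D) of LEMMA N♭ — the duality bookkeeping; crux `FInjectiveMacaulayfication` stmt-ResolutionOfSingularities-15315, chain w45a, F-centre census
# Tier-2; res-L1-w45a-plan-1 R17.14 (3) / R18.1 (3); seat res-L1-w45a-lead-1 g8; scope `Cruxes/FInjectiveMacaulayfication/Lines/LEMMA-N-SCOPE.md`)

[OURS · L1 W4.5a] Support file (`--supports stmt-ResolutionOfSingularities-15315 --as helper`); replaces the role of NO printed item; NOT a statement of any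
manuscript; def-free; AI-written (AI review is weaker than expert review).

Setting: `R` a commutative DOMAIN with `2 = 0` and elements `x, y, u, t, z` with `z² + x⁴z + (y³+u³+t³) = 0`, `x ≠ 0`, `z ≠ 0` (e.g. `A₀ = k[x,y,u,t,z]/(f)` or `𝒪_v`),
`K` a fraction field of `R`, `W = W′` the one-block matrix of `…NormBlockMatrix` (hypothesis `hW`), `X := (x⁻¹)² • W′_K` (the root rows of `√ν·√z`, `ν ⊆ {y,u,t}`).

* §1 `span_minors_scaled_le` — every minor of `X` lies in `x⁻⁸·𝔮⁴·K`, `𝔮 = (x², y, u, t, z)`: a `k`-minor of `X` is `x^{−2k}` times a `k`-minor `m` of `W′`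
  (`UnitRowMinors.det_submatrix_smul`); for `k ≤ 4`, `m ∈ 𝔫ᵏ` (`NormBlockMatrix.det_submatrix_mem_pow`) and `(x²)^{4−k}·𝔫ᵏ ⊆ 𝔮⁴`; for `5 ≤ k ≤ 8`, by JACOBI DUALITY
  (`JacobiMinor.pow_mul_det_submatrix_of_mul_self` with `W′² = x⁴z·1` from `NormBlockMatrix.mul_self_eq_smul_one` and `det W′ = (x⁴z)⁴` from `det_eq_pow_four`)
  `m = ± (x⁴z)^{k−4}·m′` with `m′` a complementary `(8−k)`-minor, so `x^{−2k} m = x⁻⁸ · (± x^{2k−8} z^{k−4} m′)` and `z^{k−4} m′ ∈ 𝔫⁴ ⊆ 𝔮⁴`; non-injective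
  selections give `0` (`UnitRowMinors.det_submatrix_eq_zero_of_not_injective`).
* §2 `scaled_le_span_minors` — conversely `x⁻⁸·𝔮⁴·K ⊆ span_R {minors of X}`: by `NormBlockCerts.pow_four_span_le`, `𝔮⁴ ⊆ (x⁸, x⁶I₁, x⁴I₂, x²I₃, I₄)(W′)` and
  `x⁻⁸·x^{8−2k}·m_k = det` of the corresponding minor of `X`.
* §3 ★ `span_minors_scaled_eq` — equality, in the currency consumed by res-L1-w45a-stub-1's `UnitRowMinors.span_maximalMinors_unitRowStack_eq` (left side) and
  `FrobeniusNormExtendScale.isFrobeniusNormIdeal_of_coeSubmodule_eq_map_mulLeft` (right side). With the K²-basis (piece (B), stub-1 g10) and the block split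
  (`BlockDiagonalMinors`), the Frobenius norm of `A₀` is the SQUARE of this module, i.e. `x⁻¹⁶·𝔮⁸·K` — LEMMA N♭.
[folklore linear algebra over OURS computation; cite: Villamayoru2006, §2 p. 123 and 3.4 (norm of a module)]
-/

-- single-problem summit: the doubled namespace component is forced
set_option linter.dupNamespace false

noncomputable section

namespace Summit.ResolutionOfSingularities.ResolutionOfSingularities.Theorems.FInjectiveMacaulayfication.NormBlockDuality

open Matrix
open Summit.ResolutionOfSingularities.ResolutionOfSingularities.Theorems.FInjectiveMacaulayfication

variable {R : Type*} [CommRing R] {K : Type*} [Field K] [Algebra R K]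

/-! ## §0 Small helpers -/

/-- `(x²)^a · m ∈ 𝔮^(a+b)` for `m ∈ 𝔫^b`, `𝔫 = (z,y,u,t) ≤ 𝔮 = (x²,y,u,t,z)`. [plumbing] -/
theorem pow_mul_mem_pow (x y u t z : R) {a b : ℕ} {m : R} (hm : m ∈ Ideal.span ({z, y, u, t} : Set R) ^ b) :
    (x ^ 2) ^ a * m ∈ Ideal.span ({x ^ 2, y, u, t, z} : Set R) ^ (a + b) := by
  have hle : Ideal.span ({z, y, u, t} : Set R) ≤ Ideal.span ({x ^ 2, y, u, t, z} : Set R) :=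
    Ideal.span_mono (by intro w hw; simp only [Set.mem_insert_iff, Set.mem_singleton_iff] at hw ⊢; tauto)
  have hx : (x ^ 2) ^ a ∈ Ideal.span ({x ^ 2, y, u, t, z} : Set R) ^ a :=
    Ideal.pow_mem_pow (Ideal.subset_span (by simp)) a
  rw [pow_add]
  exact Ideal.mul_mem_mul hx (Ideal.pow_right_mono hle b hm)

/-- `z^a · m ∈ 𝔮^(a+b)` for `m ∈ 𝔫^b`. [plumbing] -/
theorem zpow_mul_mem_pow (x y u t z : R) {a b : ℕ} {m : R} (hm : m ∈ Ideal.span ({z, y, u, t} : Set R) ^ b) :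
    z ^ a * m ∈ Ideal.span ({x ^ 2, y, u, t, z} : Set R) ^ (a + b) := by
  have hle : Ideal.span ({z, y, u, t} : Set R) ≤ Ideal.span ({x ^ 2, y, u, t, z} : Set R) :=
    Ideal.span_mono (by intro w hw; simp only [Set.mem_insert_iff, Set.mem_singleton_iff] at hw ⊢; tauto)
  have hz : z ^ a ∈ Ideal.span ({x ^ 2, y, u, t, z} : Set R) ^ a :=
    Ideal.pow_mem_pow (Ideal.subset_span (by simp)) a
  rw [pow_add]
  exact Ideal.mul_mem_mul hz (Ideal.pow_right_mono hle b hm)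

/-- Membership in `v · (I·K)`: it suffices to exhibit `q ∈ I` with `w = v * algebraMap q`. [plumbing] -/
theorem mem_map_mulLeft_of_eq (I : Ideal R) (v w : K) (q : R) (hq : q ∈ I) (h : w = v * algebraMap R K q) :
    w ∈ (IsLocalization.coeSubmodule K I).map (LinearMap.mulLeft R v) := by
  refine Submodule.mem_map.mpr ⟨algebraMap R K q, ?_, ?_⟩
  · exact (IsLocalization.mem_coeSubmodule K I).mpr ⟨q, hq, rfl⟩
  · rw [LinearMap.mulLeft_apply, h]

/-! ## §1 `W′² = x⁴z·1`, `det W′ = (x⁴z)⁴`, and Jacobi duality in selection form -/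

/-- `W′² = (x⁴z)·1` in `R` (from `NormBlockMatrix.mul_self_eq_smul_one` and `f = 0`). [plumbing] -/
theorem mul_self_eq (h2 : (2 : R) = 0) (x y u t z : R) (hf : z ^ 2 + x ^ 4 * z + (y ^ 3 + u ^ 3 + t ^ 3) = 0)
    (W : Matrix (Fin 8) (Fin 8) R)
    (hW : W = !![z, y, u, t, 0, 0, 0, 0;
      y ^ 2, z, 0, 0, u, t, 0, 0;
      u ^ 2, 0, z, 0, y, 0, t, 0;
      t ^ 2, 0, 0, z, 0, y, u, 0;
      0, u ^ 2, y ^ 2, 0, z, 0, 0, t;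
      0, t ^ 2, 0, y ^ 2, 0, z, 0, u;
      0, 0, t ^ 2, u ^ 2, 0, 0, z, y;
      0, 0, 0, 0, t ^ 2, u ^ 2, y ^ 2, z]) :
    W * W = (x ^ 4 * z) • (1 : Matrix (Fin 8) (Fin 8) R) := by
  have h4 : x ^ 4 * z + x ^ 4 * z = 0 := by rw [← two_mul, h2, zero_mul]
  have hzg : z ^ 2 + (y ^ 3 + u ^ 3 + t ^ 3) = x ^ 4 * z := by linear_combination hf - h4
  rw [NormBlockMatrix.mul_self_eq_smul_one h2 y u t z W hW, hzg]

/-- `det W′ = (x⁴z)⁴` in a domain `R`. [plumbing] -/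
theorem det_eq [IsDomain R] (h2 : (2 : R) = 0) (x y u t z : R) (hf : z ^ 2 + x ^ 4 * z + (y ^ 3 + u ^ 3 + t ^ 3) = 0)
    (W : Matrix (Fin 8) (Fin 8) R)
    (hW : W = !![z, y, u, t, 0, 0, 0, 0;
      y ^ 2, z, 0, 0, u, t, 0, 0;
      u ^ 2, 0, z, 0, y, 0, t, 0;
      t ^ 2, 0, 0, z, 0, y, u, 0;
      0, u ^ 2, y ^ 2, 0, z, 0, 0, t;
      0, t ^ 2, 0, y ^ 2, 0, z, 0, u;
      0, 0, t ^ 2, u ^ 2, 0, 0, z, y;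
      0, 0, 0, 0, t ^ 2, u ^ 2, y ^ 2, z]) :
    W.det = (x ^ 4 * z) ^ 4 := by
  have h4 : x ^ 4 * z + x ^ 4 * z = 0 := by rw [← two_mul, h2, zero_mul]
  have hzg : z ^ 2 + (y ^ 3 + u ^ 3 + t ^ 3) = x ^ 4 * z := by linear_combination hf - h4
  rw [NormBlockMatrix.det_eq_pow_four h2 y u t z W hW, hzg]

/-- **JACOBI DUALITY FOR `W′`, selection form**: for injective `r c : Fin k → Fin 8` with `4 ≤ k`, the `k`-minor `det W′_{r,c}` is `± (x⁴z)^{k−4}` times the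
determinant of a complementary submatrix (indexed by the complement of `range r`). [folklore, via `JacobiMinor.pow_mul_det_submatrix_of_mul_self`] -/
theorem minor_eq_pow_mul_compl [IsDomain R] (h2 : (2 : R) = 0) (x y u t z : R) (hf : z ^ 2 + x ^ 4 * z + (y ^ 3 + u ^ 3 + t ^ 3) = 0)
    (hx : x ≠ 0) (hz : z ≠ 0) (W : Matrix (Fin 8) (Fin 8) R)
    (hW : W = !![z, y, u, t, 0, 0, 0, 0;
      y ^ 2, z, 0, 0, u, t, 0, 0;
      u ^ 2, 0, z, 0, y, 0, t, 0;
      t ^ 2, 0, 0, z, 0, y, u, 0;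
      0, u ^ 2, y ^ 2, 0, z, 0, 0, t;
      0, t ^ 2, 0, y ^ 2, 0, z, 0, u;
      0, 0, t ^ 2, u ^ 2, 0, 0, z, y;
      0, 0, 0, 0, t ^ 2, u ^ 2, y ^ 2, z])
    {k : ℕ} (hk : 4 ≤ k) (r c : Fin k → Fin 8) (hr : Function.Injective r) (hc : Function.Injective c) :
    ∃ (ε : ℤˣ) (r' c' : ↥((Set.range r)ᶜ) → Fin 8),
      (W.submatrix r c).det = ((ε : ℤ) : R) * (x ^ 4 * z) ^ (k - 4) * (W.submatrix r' c').det := by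
  classical
  have hcard_r : Fintype.card ↥(Set.range r) = k := by rw [Set.card_range_of_injective hr, Fintype.card_fin]
  have hcard_c : Fintype.card ↥(Set.range c) = k := by rw [Set.card_range_of_injective hc, Fintype.card_fin]
  have hcc : Fintype.card ↥((Set.range r)ᶜ) = Fintype.card ↥((Set.range c)ᶜ) := by
    rw [Fintype.card_compl_set, Fintype.card_compl_set, hcard_r, hcard_c]
  let ecn : ↥((Set.range r)ᶜ) ≃ ↥((Set.range c)ᶜ) := Fintype.equivOfCardEq hcc
  let er : Fin k ⊕ ↥((Set.range r)ᶜ) ≃ Fin 8 := (Equiv.sumCongr (Equiv.ofInjective r hr) (Equiv.refl _)).trans (Equiv.Set.sumCompl _)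
  let ec : Fin k ⊕ ↥((Set.range r)ᶜ) ≃ Fin 8 := (Equiv.sumCongr (Equiv.ofInjective c hc) ecn).trans (Equiv.Set.sumCompl _)
  have her : er ∘ Sum.inl = r := by funext i; simp [er]
  have hec : ec ∘ Sum.inl = c := by funext i; simp [ec]
  have J := JacobiMinor.pow_mul_det_submatrix_of_mul_self (m := Fin k) (n := ↥((Set.range r)ᶜ)) W (x ^ 4 * z)
    (mul_ne_zero (pow_ne_zero _ hx) hz) (mul_self_eq h2 x y u t z hf W hW) er.symm ec.symm
  simp only [Equiv.symm_symm] at J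
  rw [her, hec, det_eq h2 x y u t z hf W hW, Fintype.card_compl_set, hcard_r, Fintype.card_fin] at J
  have hk8 : k ≤ 8 := by simpa using Fintype.card_le_of_injective r hr
  have hsplit : (x ^ 4 * z) ^ 4 = (x ^ 4 * z) ^ (8 - k) * (x ^ 4 * z) ^ (k - 4) := by
    rw [← pow_add]; congr 1; omega
  refine ⟨Equiv.Perm.sign (ec.trans er.symm), ec ∘ Sum.inr, er ∘ Sum.inr, ?_⟩
  have hne : (x ^ 4 * z) ^ (8 - k) ≠ 0 := pow_ne_zero _ (mul_ne_zero (pow_ne_zero _ hx) hz)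
  apply mul_left_cancel₀ hne
  rw [J, hsplit]
  ring

/-! ## §2 Every minor of `X = x⁻²·W′_K` lies in `x⁻⁸·𝔮⁴·K` -/

/-- **§2**: the `k × k` minors of `X = (x⁻¹)²·W′_K` lie in `x⁻⁸·(𝔮⁴·K)`, `𝔮 = (x², y, u, t, z)`. [OURS · piece (D) of LEMMA N♭] -/
theorem det_submatrix_scaled_mem [IsDomain R] [IsFractionRing R K] (h2 : (2 : R) = 0) (x y u t z : R) (hf : z ^ 2 + x ^ 4 * z + (y ^ 3 + u ^ 3 + t ^ 3) = 0)
    (hx : x ≠ 0) (hz : z ≠ 0) (W : Matrix (Fin 8) (Fin 8) R)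
    (hW : W = !![z, y, u, t, 0, 0, 0, 0;
      y ^ 2, z, 0, 0, u, t, 0, 0;
      u ^ 2, 0, z, 0, y, 0, t, 0;
      t ^ 2, 0, 0, z, 0, y, u, 0;
      0, u ^ 2, y ^ 2, 0, z, 0, 0, t;
      0, t ^ 2, 0, y ^ 2, 0, z, 0, u;
      0, 0, t ^ 2, u ^ 2, 0, 0, z, y;
      0, 0, 0, 0, t ^ 2, u ^ 2, y ^ 2, z])
    {k : ℕ} (r c : Fin k → Fin 8) :
    ((((algebraMap R K x)⁻¹ ^ 2) • W.map (algebraMap R K)).submatrix r c).det ∈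
      (IsLocalization.coeSubmodule K (Ideal.span ({x ^ 2, y, u, t, z} : Set R) ^ 4)).map
        (LinearMap.mulLeft R ((algebraMap R K x)⁻¹ ^ 8)) := by
  classical
  have hxK0 : algebraMap R K x ≠ 0 :=
    IsFractionRing.to_map_ne_zero_of_mem_nonZeroDivisors (mem_nonZeroDivisors_of_ne_zero hx)
  -- the minor of `X` is `x^{-2k}` times the image of the minor of `W′`
  have hdet : ((((algebraMap R K x)⁻¹ ^ 2) • W.map (algebraMap R K)).submatrix r c).det =
      ((algebraMap R K x)⁻¹ ^ 2) ^ k * algebraMap R K ((W.submatrix r c).det) := by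
    rw [UnitRowMinors.det_submatrix_smul, Matrix.submatrix_map, RingHom.map_det, RingHom.mapMatrix_apply]
  rw [hdet]
  by_cases hinj : Function.Injective r ∧ Function.Injective c
  swap
  · rw [UnitRowMinors.det_submatrix_eq_zero_of_not_injective W r c (not_and_or.mp hinj), map_zero, mul_zero]
    exact Submodule.zero_mem _
  obtain ⟨hr, hc⟩ := hinj
  have hk8 : k ≤ 8 := by simpa using Fintype.card_le_of_injective r hr
  rcases le_or_gt k 4 with hk4 | hk4
  · -- small minors: `m ∈ 𝔫ᵏ` and `x^{-2k}·m = x⁻⁸ · ((x²)^{4-k}·m)`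
    have hm := NormBlockMatrix.det_submatrix_mem_pow y u t z W hW r c
    have hq : (x ^ 2) ^ (4 - k) * (W.submatrix r c).det ∈ Ideal.span ({x ^ 2, y, u, t, z} : Set R) ^ 4 := by
      have := pow_mul_mem_pow x y u t z (a := 4 - k) hm
      rwa [show 4 - k + k = 4 by omega] at this
    refine mem_map_mulLeft_of_eq _ _ _ _ hq ?_
    rw [map_mul, map_pow, map_pow]
    interval_cases k <;> (field_simp; ring)
  · -- large minors: Jacobi duality `m = ± (x⁴z)^{k-4}·m′`, `m′` a complementary `(8−k)`-minor, so `m′ ∈ 𝔫^{8−k}`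
    obtain ⟨ε, r', c', hε⟩ := minor_eq_pow_mul_compl h2 x y u t z hf hx hz W hW hk4.le r c hr hc
    have hm' : (W.submatrix r' c').det ∈ Ideal.span ({z, y, u, t} : Set R) ^ (8 - k) := by
      have h := NormBlockMatrix.det_mem_pow_of_forall_mem (Ideal.span ({z, y, u, t} : Set R)) (W.submatrix r' c')
        fun i j => NormBlockMatrix.entry_mem_span y u t z W hW (r' i) (c' j)
      rwa [Fintype.card_compl_set, Set.card_range_of_injective hr, Fintype.card_fin, Fintype.card_fin] at h
    have hq : ((ε : ℤ) : R) * x ^ (2 * k - 8) * (z ^ (k - 4) * (W.submatrix r' c').det) ∈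
        Ideal.span ({x ^ 2, y, u, t, z} : Set R) ^ 4 := by
      refine Ideal.mul_mem_left _ _ ?_
      have := zpow_mul_mem_pow x y u t z (a := k - 4) hm'
      rwa [show k - 4 + (8 - k) = 4 by omega] at this
    refine mem_map_mulLeft_of_eq _ _ _ _ hq ?_
    rw [hε]
    simp only [map_mul, map_pow, map_intCast]
    interval_cases k <;> (field_simp; ring)

/-- **§2 as an inclusion of `R`-submodules of `K`.** [OURS] -/
theorem span_minors_scaled_le [IsDomain R] [IsFractionRing R K] (h2 : (2 : R) = 0) (x y u t z : R) (hf : z ^ 2 + x ^ 4 * z + (y ^ 3 + u ^ 3 + t ^ 3) = 0)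
    (hx : x ≠ 0) (hz : z ≠ 0) (W : Matrix (Fin 8) (Fin 8) R)
    (hW : W = !![z, y, u, t, 0, 0, 0, 0;
      y ^ 2, z, 0, 0, u, t, 0, 0;
      u ^ 2, 0, z, 0, y, 0, t, 0;
      t ^ 2, 0, 0, z, 0, y, u, 0;
      0, u ^ 2, y ^ 2, 0, z, 0, 0, t;
      0, t ^ 2, 0, y ^ 2, 0, z, 0, u;
      0, 0, t ^ 2, u ^ 2, 0, 0, z, y;
      0, 0, 0, 0, t ^ 2, u ^ 2, y ^ 2, z]) :
    Submodule.span R {d : K | ∃ (k : ℕ) (r c : Fin k → Fin 8),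
        d = ((((algebraMap R K x)⁻¹ ^ 2) • W.map (algebraMap R K)).submatrix r c).det} ≤
      (IsLocalization.coeSubmodule K (Ideal.span ({x ^ 2, y, u, t, z} : Set R) ^ 4)).map
        (LinearMap.mulLeft R ((algebraMap R K x)⁻¹ ^ 8)) := by
  refine Submodule.span_le.mpr ?_
  rintro d ⟨k, r, c, rfl⟩
  exact det_submatrix_scaled_mem h2 x y u t z hf hx hz W hW r c

/-! ## §3 Conversely `x⁻⁸·𝔮⁴·K ⊆ span_R (minors of X)` — from the certificates of `…NormBlockCerts` -/

/-- **§3**: `x⁻⁸·(𝔮⁴·K)` is contained in the `R`-span of the minors of `X = (x⁻¹)²·W′_K`: by `NormBlockCerts.pow_four_span_le`, `𝔮⁴ ⊆ (x⁸, x⁶I₁, x⁴I₂, x²I₃, I₄)(W′)`, and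
`x⁻⁸ · x^{8−2k} · m_k` is the corresponding `k`-minor of `X`. [OURS · piece (D) of LEMMA N♭] -/
theorem scaled_le_span_minors [IsDomain R] [IsFractionRing R K] (h2 : (2 : R) = 0) (x y u t z : R) (hx : x ≠ 0) (W : Matrix (Fin 8) (Fin 8) R)
    (hW : W = !![z, y, u, t, 0, 0, 0, 0;
      y ^ 2, z, 0, 0, u, t, 0, 0;
      u ^ 2, 0, z, 0, y, 0, t, 0;
      t ^ 2, 0, 0, z, 0, y, u, 0;
      0, u ^ 2, y ^ 2, 0, z, 0, 0, t;
      0, t ^ 2, 0, y ^ 2, 0, z, 0, u;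
      0, 0, t ^ 2, u ^ 2, 0, 0, z, y;
      0, 0, 0, 0, t ^ 2, u ^ 2, y ^ 2, z]) :
    (IsLocalization.coeSubmodule K (Ideal.span ({x ^ 2, y, u, t, z} : Set R) ^ 4)).map
        (LinearMap.mulLeft R ((algebraMap R K x)⁻¹ ^ 8)) ≤
      Submodule.span R {d : K | ∃ (k : ℕ) (r c : Fin k → Fin 8),
        d = ((((algebraMap R K x)⁻¹ ^ 2) • W.map (algebraMap R K)).submatrix r c).det} := by
  classical
  have hxK0 : algebraMap R K x ≠ 0 :=
    IsFractionRing.to_map_ne_zero_of_mem_nonZeroDivisors (mem_nonZeroDivisors_of_ne_zero hx)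
  set S : Submodule R K := Submodule.span R {d : K | ∃ (k : ℕ) (r c : Fin k → Fin 8),
        d = ((((algebraMap R K x)⁻¹ ^ 2) • W.map (algebraMap R K)).submatrix r c).det} with hS
  -- the minors of `X` versus those of `W′`
  have hdet : ∀ {k : ℕ} (r c : Fin k → Fin 8), ((((algebraMap R K x)⁻¹ ^ 2) • W.map (algebraMap R K)).submatrix r c).det =
      ((algebraMap R K x)⁻¹ ^ 2) ^ k * algebraMap R K ((W.submatrix r c).det) := fun r c => by
    rw [UnitRowMinors.det_submatrix_smul, Matrix.submatrix_map, RingHom.map_det, RingHom.mapMatrix_apply]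
  have hmem : ∀ {k : ℕ} (r c : Fin k → Fin 8), ((algebraMap R K x)⁻¹ ^ 2) ^ k * algebraMap R K ((W.submatrix r c).det) ∈ S :=
    fun r c => by rw [← hdet]; exact Submodule.subset_span ⟨_, r, c, rfl⟩
  -- push `𝔮⁴ ≤ 𝔔` to `K`
  have hC := NormBlockCerts.pow_four_span_le h2 x y u t z W hW
  refine le_trans (Submodule.map_mono (IsLocalization.coeSubmodule_mono K hC)) ?_
  rw [IsLocalization.coeSubmodule_span, Submodule.map_span]
  refine Submodule.span_le.mpr ?_
  rintro _ ⟨_, ⟨d, hd, rfl⟩, rfl⟩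
  rw [SetLike.mem_coe, LinearMap.mulLeft_apply]
  rcases hd with rfl | ⟨i, j, rfl⟩ | ⟨r, c, rfl⟩ | ⟨r, c, rfl⟩ | ⟨r, c, rfl⟩
  · -- `x⁸`: the empty minor
    have h := hmem (k := 0) Fin.elim0 Fin.elim0
    rw [Matrix.det_isEmpty, map_one, mul_one, pow_zero] at h
    have e : (algebraMap R K x)⁻¹ ^ 8 * algebraMap R K (x ^ 8) = 1 := by rw [map_pow]; field_simp
    rw [e]; exact h
  · -- `x⁶ · W i j`: a `1 × 1` minor
    have h := hmem (k := 1) ![i] ![j]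
    have hsub : (W.submatrix ![i] ![j]).det = W i j := by rw [Matrix.det_unique]; rfl
    rw [hsub] at h
    have e : (algebraMap R K x)⁻¹ ^ 8 * algebraMap R K (x ^ 6 * W i j) = ((algebraMap R K x)⁻¹ ^ 2) ^ 1 * algebraMap R K (W i j) := by
      rw [map_mul, map_pow]; field_simp
    rw [e]; exact h
  · have h := hmem r c
    have e : (algebraMap R K x)⁻¹ ^ 8 * algebraMap R K (x ^ 4 * (W.submatrix r c).det) =
        ((algebraMap R K x)⁻¹ ^ 2) ^ 2 * algebraMap R K ((W.submatrix r c).det) := by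
      rw [map_mul, map_pow]; field_simp
    rw [e]; exact h
  · have h := hmem r c
    have e : (algebraMap R K x)⁻¹ ^ 8 * algebraMap R K (x ^ 2 * (W.submatrix r c).det) =
        ((algebraMap R K x)⁻¹ ^ 2) ^ 3 * algebraMap R K ((W.submatrix r c).det) := by
      rw [map_mul, map_pow]; field_simp
    rw [e]; exact h
  · have h := hmem r c
    have e : (algebraMap R K x)⁻¹ ^ 8 * algebraMap R K ((W.submatrix r c).det) =
        ((algebraMap R K x)⁻¹ ^ 2) ^ 4 * algebraMap R K ((W.submatrix r c).det) := by ring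
    rw [e]; exact h

/-! ## §4 The one-block norm module -/

/-- ★ **THE ONE-BLOCK NORM MODULE OF P2d4C**: for a domain `R` with `2 = 0`, `z² + x⁴z + (y³+u³+t³) = 0`, `x ≠ 0`, `z ≠ 0`, and a fraction field `K`, the `R`-span of ALL minors
of `X = (x⁻¹)²·W′_K` (the root-row block `[…; x⁻²W′]` minus its unit rows, cf. `UnitRowMinors.span_maximalMinors_unitRowStack_eq`) is EXACTLY `x⁻⁸·(𝔮⁴·K)`,
`𝔮 = (x², y, u, t, z)`. With res-L1-w45a-stub-1's root-row/block-diagonal/unit-row lemmas and the K²-basis this yields the Frobenius norm class `K^×·𝔮⁸` of `A₀` and of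
`𝒪_v` (LEMMA N♭). [OURS · piece (D) of LEMMA N♭; cite: Villamayoru2006, §2 p. 123 and 3.4] -/
theorem span_minors_scaled_eq [IsDomain R] [IsFractionRing R K] (h2 : (2 : R) = 0) (x y u t z : R) (hf : z ^ 2 + x ^ 4 * z + (y ^ 3 + u ^ 3 + t ^ 3) = 0)
    (hx : x ≠ 0) (hz : z ≠ 0) (W : Matrix (Fin 8) (Fin 8) R)
    (hW : W = !![z, y, u, t, 0, 0, 0, 0;
      y ^ 2, z, 0, 0, u, t, 0, 0;
      u ^ 2, 0, z, 0, y, 0, t, 0;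
      t ^ 2, 0, 0, z, 0, y, u, 0;
      0, u ^ 2, y ^ 2, 0, z, 0, 0, t;
      0, t ^ 2, 0, y ^ 2, 0, z, 0, u;
      0, 0, t ^ 2, u ^ 2, 0, 0, z, y;
      0, 0, 0, 0, t ^ 2, u ^ 2, y ^ 2, z]) :
    Submodule.span R {d : K | ∃ (k : ℕ) (r c : Fin k → Fin 8),
        d = ((((algebraMap R K x)⁻¹ ^ 2) • W.map (algebraMap R K)).submatrix r c).det} =
      (IsLocalization.coeSubmodule K (Ideal.span ({x ^ 2, y, u, t, z} : Set R) ^ 4)).map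
        (LinearMap.mulLeft R ((algebraMap R K x)⁻¹ ^ 8)) :=
  le_antisymm (span_minors_scaled_le h2 x y u t z hf hx hz W hW) (scaled_le_span_minors h2 x y u t z hx W hW)

end Summit.ResolutionOfSingularities.ResolutionOfSingularities.Theorems.FInjectiveMacaulayfication.NormBlockDuality

end
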